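import Mathlib.AlgebraicGeometry.AffineSpace
import Mathlib.AlgebraicGeometry.Noetherian
import Mathlib.RingTheory.RegularLocalRing.Polynomial
import Literature.AlgebraicGeometry.Resolution.ProjectiveSpaceRegular
import Literature.AlgebraicGeometry.Resolution.PrincipalizationToResolution
import HarnessLib

/-!
# Affine space over a regular scheme is regular (crux `FrobeniusLadder.FRationalResolution`, line `Sketch`)

Stub `stub_isRegular_affineSpace` of the skeleton `Sketch` for crux
stmt-ResolutionOfSingularities-15317, theme "resolutions pull back along affine spaces"
(`HasResolution X ⇒ HasResolution 𝔸ⁿ_X`): the source `𝔸ⁿ_{X'}` of the pulled-back resolution is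
regular because `X'` is. For a locally Noetherian regular scheme `X` and `n : ℕ`, the affine space
`𝔸(Fin n; X)` (Mathlib `AlgebraicGeometry.AffineSpace`) is regular in the sense of
`Literature.AlgebraicGeometry.Resolution.Scheme.IsRegular` (all local rings are regular local rings).

Proof: this is the universe-`0`, `Fin n`-indexed instance of the tree's
`Literature.AlgebraicGeometry.Resolution.Scheme.IsRegular.affineSpace`
(`Literature/AlgebraicGeometry/Resolution/PrincipalizationToResolution.lean`, stated for any finite
index type and any universe), which covers `𝔸ⁿ_X` by the open pieces
`𝔸ⁿ_{Spec R} ≅ Spec R[x₁,…,xₙ]` (`AffineSpace.SpecIso`) over the affine charts `Spec R ⊆ X`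
(`AffineSpace.map` of an open immersion is an open immersion, being its base change by
`AffineSpace.isPullback_map`; its range is the preimage of the chart by
`Scheme.Pullback.exists_preimage_pullback`), where `R` is a Noetherian regular ring
(`Scheme.isRegular_Spec_iff`, `Scheme.IsRegular.of_isOpenImmersion`) and hence so is `R[x₁,…,xₙ]`
(Matsumura, *Commutative Ring Theory*, Thm. 19.5; Mathlib `MvPolynomial.isRegularRing_of_isRegularRing`),
and concludes with `Scheme.IsRegular.of_forall_exists_isOpenImmersion`.
-/

set_option linter.dupNamespace false

noncomputable section

open CategoryTheory CategoryTheory.Limits AlgebraicGeometry TopologicalSpace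
  Literature.AlgebraicGeometry.Resolution

namespace Summit.ResolutionOfSingularities.ResolutionOfSingularities.Theorems.FRationalResolution

/-- **Affine space over a regular scheme is regular**: for a locally Noetherian regular scheme `X`
and `n : ℕ`, `𝔸(Fin n; X)` is regular (locally it is `Spec R[x₁,…,xₙ]` with `R` a regular ring,
and polynomial rings in finitely many variables over regular rings are regular). The universe-`0`,
`Fin n`-indexed instance of the tree's `Scheme.IsRegular.affineSpace`. -/
theorem stub_isRegular_affineSpace (n : ℕ) (X : Scheme.{0}) [IsLocallyNoetherian X]
    (hX : Scheme.IsRegular X) : Scheme.IsRegular (AffineSpace (Fin n) X) := by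
  exact hX.affineSpace (Fin n)

end Summit.ResolutionOfSingularities.ResolutionOfSingularities.Theorems.FRationalResolution

end
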